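import Mathlib.Data.Real.Basic
import Mathlib.Tactic.Linarith
import Mathlib.Tactic.Ring
import Mathlib.Tactic.FieldSimp
import Mathlib.Tactic.Positivity
import Mathlib.Tactic.LinearCombination
import HarnessLib

/-!
# QUANT lane R8, T-DEC, leg (III), blob case — `LawDec.GatedSliceMixLaw'`, Q-ALONE side: the last scalar inequality of cell QK
# (class `LM`: twin above `t`, the top LIGHT at the twin, the low `k₁` HEAVY)

builds on p205010 (kernel theorem, internal audit signed; external expert review pending)

Support file (`--supports stmt-CriticalPhenomena-4575`), QUANT lane seat prim-quant-arm-1 (gen 41), rung R8 of `run/shared/lean/prim/quant/LADDER.md`.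
Pure real arithmetic.  Notation as in `…QKIneq` (`m = 1 − z`, `A,B,C,D`, `S = m(k₁ + λ(k₂−k₁))`, `t = S + agm`, `P = k₁ + a`, `p = P − t`,
`W₁ = t − 2k₁`, `W₂ = t − 2k₂`, `d₂ = P − k₂`, `E = 1 − B − C`, `X = yE − D`, `σ = mg − y`, `Δ₀ = S − 2k₁`).  With the heavy rate
`usage(k₁,P) = W₁/(p + k₁)` and the light rate `usage(k₂,P) = γ/(1−γ)`, `γ = y² + (1−y)W₂/d₂`, the saturation inequality (Ib)
`usage(k₁,P)·X ≤ y(B − usage(k₂,P)·C)` multiplied by `(p+k₁)·d₂(1−γ) > 0` reads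
  `W₁·X·(d₂ − y²d₂ − (1−y)W₂) ≤ y(p+k₁)(B(d₂ − y²d₂ − (1−y)W₂) − (y²d₂ + (1−y)W₂)C)`   (**`qk_Ib_lh`**).
PROOF.  It follows (identity `2d₂·R = Q·T + (p+k₁)yC(yd₂ − W₂)(d₂ − yd₂ + W₂)`, `Q = d₂ + yd₂ − W₂ > 0`) from the simpler
  `T(y) := (p+k₁)·y·(2σd₂ + C(yd₂ − W₂)) − 2d₂(W₁ − ya)·X ≥ 0`,
a quadratic in `y`.  Case `Δ₀ ≤ 0`: `T = 2σd₂[a(Cy + D(1−y)) − Δ₀y] + (p+k₁)yC(yd₂ − W₂) − 2d₂Δ₀X ≥ 0` termwise.  Case `Δ₀ > 0`, on the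
interval `[Y₂, Y]`, `Y₂ = W₂/d₂ < y ≤ Y := min(mg, S/k₂)`: (i) `T(Y₂) ≥ 0` — at `y = Y₂` the top is exactly balanced and (Ib) there follows from
the heavy-top inequality `qk_Ib_heavyTop` (R4, with the cruder `usage(k₁,P) ≤ (t−k₁)/p`); (ii) `T(Y) ≥ 0` and (iii) `T'(Y) ≤ 0` are y-free facts;
then `T ≥ 0` on `[Y₂, Y]`: if the leading coefficient `c₂ = d₂((p+k₁)(C−2) + 2aE)` is `≥ 0`, `T(y) = T(Y) − (Y−y)T'(Y) + c₂(Y−y)² ≥ 0`, else `T`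
is concave and lies above its chord.  The facts (ii)/(iii): `T(mg)`, `T(S/k₂)`, `−T'(S/k₂)` are quadratic (the first affine) in the shift `a` with
nonnegative leading coefficient, and `mg·(a − a₀) = W₂ ≥ 0` for `a₀ := (2k₂ − S)/(mg)`; so each is `≥` its tangent at `a₀`, whose value and slope
are the a-free polynomials `qkFA … qkFF ≥ 0` — explicit Positivstellensatz certificates found by LP (kit jobs, `work/psatz`), as is `T'(mg) ≤ 0`.
HONEST STATUS: `GatedSliceMixLaw'` (regime R), CW, `GateMove`, `GatedConvEmptyFree`, `SingleGateConvClosed`, `TreeDEC`, `FarTreeRow` OPEN; RATE unchanged.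

[this work].  Nothing here is cited as a published result.
-/

namespace Summit.CriticalPhenomena.PercolationContinuityZ3.Theorems

namespace Quant

namespace LawDec

/-! ### the polynomials `T(y)` (CL2), `T'(y)`, and the a-free endpoint polynomials -/

/-- `T(y)` of the file header, as an explicit polynomial. -/
noncomputable def qkT (y z g lam S k₁ k₂ a : ℝ) : ℝ :=
  ((k₁ + a - (S + a * g * (1 - z))) + k₁) * y *
      (2 * ((1 - z) * g - y) * (k₁ + a - k₂) + (1 - z) * lam * (1 - g) * (y * (k₁ + a - k₂) - (S + a * g * (1 - z) - 2 * k₂)))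
    - 2 * (k₁ + a - k₂) * ((S + a * g * (1 - z) - 2 * k₁) - y * a)
      * (y * (1 - (1 - z) * (1 - lam) * g - (1 - z) * lam * (1 - g)) - (1 - z) * lam * g)

/-- `T'(y)`, the derivative of `qkT` in `y`. -/
noncomputable def qkD (y z g lam S k₁ k₂ a : ℝ) : ℝ :=
  ((k₁ + a - (S + a * g * (1 - z))) + k₁) *
      (2 * ((1 - z) * g - y) * (k₁ + a - k₂) + (1 - z) * lam * (1 - g) * (y * (k₁ + a - k₂) - (S + a * g * (1 - z) - 2 * k₂))
        - (2 - (1 - z) * lam * (1 - g)) * y * (k₁ + a - k₂))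
    + 2 * a * (y * (1 - (1 - z) * (1 - lam) * g - (1 - z) * lam * (1 - g)) - (1 - z) * lam * g) * (k₁ + a - k₂)
    - 2 * ((S + a * g * (1 - z) - 2 * k₁) - y * a) * (1 - (1 - z) * (1 - lam) * g - (1 - z) * lam * (1 - g)) * (k₁ + a - k₂)

/-- leading coefficient of `T` in `y`: `c₂ = d₂((p+k₁)(C−2) + 2aE)`. -/
noncomputable def qkLead (z g lam S k₁ k₂ a : ℝ) : ℝ :=
  (k₁ + a - k₂) * (((k₁ + a - (S + a * g * (1 - z))) + k₁) * ((1 - z) * lam * (1 - g) - 2)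
    + 2 * a * (1 - (1 - z) * (1 - lam) * g - (1 - z) * lam * (1 - g)))

/-- Taylor identity at `Y` (exact, `T` is quadratic in `y`). -/
theorem qkT_taylor (y Y z g lam S k₁ k₂ a : ℝ) :
    qkT y z g lam S k₁ k₂ a = qkT Y z g lam S k₁ k₂ a - (Y - y) * qkD Y z g lam S k₁ k₂ a + qkLead z g lam S k₁ k₂ a * (Y - y) ^ 2 := by
  unfold qkT qkD qkLead; ring

/-- chord identity between `Y₂` and `Y` (exact, `T` is quadratic in `y`). -/
theorem qkT_chord (y Y Y₂ z g lam S k₁ k₂ a : ℝ) :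
    (Y - Y₂) * qkT y z g lam S k₁ k₂ a = (Y - y) * qkT Y₂ z g lam S k₁ k₂ a + (y - Y₂) * qkT Y z g lam S k₁ k₂ a
      - qkLead z g lam S k₁ k₂ a * (y - Y₂) * (Y - y) * (Y - Y₂) := by
  unfold qkT qkLead; ring

/-! ### the endpoint `Y = mg`: `mg·T(mg) = W₂·FA + R₂·FB` (`T(mg)` is affine in `a`) -/

/-- slope of `T(mg)` in `a` (a-free): `FA = (1−mg)·mg·C·R₂ − 2Δ₀X₀`, `R₂ = 2k₂ − S − mg(k₂−k₁)`, `X₀ = mgE − D`. -/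
noncomputable def qkFA (z g lam S k₁ k₂ : ℝ) : ℝ :=
  (1 - (1 - z) * g) * ((1 - z) * g) * ((1 - z) * lam * (1 - g)) * (2 * k₂ - S - (1 - z) * g * (k₂ - k₁))
    - 2 * (S - 2 * k₁) * (((1 - z) * g) * (1 - (1 - z) * (1 - lam) * g - (1 - z) * lam * (1 - g)) - (1 - z) * lam * g)

/-- value part of `T(mg)` at `a₀ = (2k₂−S)/(mg)` (a-free): `FB = mg·C·((2k₂−S)(1−mg) − Δ₀·mg) − 2Δ₀X₀`. -/
noncomputable def qkFB (z g lam S k₁ k₂ : ℝ) : ℝ :=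
  ((1 - z) * g) * ((1 - z) * lam * (1 - g)) * ((2 * k₂ - S) * (1 - (1 - z) * g) - (S - 2 * k₁) * ((1 - z) * g))
    - 2 * (S - 2 * k₁) * (((1 - z) * g) * (1 - (1 - z) * (1 - lam) * g - (1 - z) * lam * (1 - g)) - (1 - z) * lam * g)

/-- `mg·T(mg) = W₂·FA + R₂·FB`. -/
theorem qkT_mg_split (z g lam S k₁ k₂ a : ℝ) :
    ((1 - z) * g) * qkT ((1 - z) * g) z g lam S k₁ k₂ a
      = (S + a * g * (1 - z) - 2 * k₂) * qkFA z g lam S k₁ k₂ + (2 * k₂ - S - (1 - z) * g * (k₂ - k₁)) * qkFB z g lam S k₁ k₂ := by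
  unfold qkT qkFA qkFB; ring

/-! ### the endpoint `Y = S/k₂`: `T(Y)` and `−T'(Y)` are convex quadratics in `a` -/

/-- `a²`-coefficient of `T(Y)`: `σ_Y(Y·C(1+mg) + 2D(1−Y)) ≥ 0`. -/
noncomputable def qkTa2 (Y z g lam : ℝ) : ℝ :=
  ((1 - z) * g - Y) * (Y * ((1 - z) * lam * (1 - g)) * (1 + (1 - z) * g) + 2 * ((1 - z) * lam * g) * (1 - Y))

/-- `a¹`-coefficient of `T(Y)`. -/
noncomputable def qkTa1 (Y z g lam S k₁ k₂ : ℝ) : ℝ :=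
  (1 - (1 - z) * g) * Y * (((1 - z) * lam * (1 - g)) * (2 * k₂ - S - Y * (k₂ - k₁)) - 2 * ((1 - z) * g - Y) * (k₂ - k₁))
    - (S - 2 * k₁) * Y * ((1 - z) * g - Y) * (2 - (1 - z) * lam * (1 - g))
    - 2 * (Y * (1 - (1 - z) * (1 - lam) * g - (1 - z) * lam * (1 - g)) - (1 - z) * lam * g) * ((S - 2 * k₁) - (k₂ - k₁) * ((1 - z) * g - Y))

/-- `a⁰`-coefficient of `T(Y)`. -/
noncomputable def qkTa0 (Y z g lam S k₁ k₂ : ℝ) : ℝ :=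
  -(S - 2 * k₁) * Y * (((1 - z) * lam * (1 - g)) * (2 * k₂ - S - Y * (k₂ - k₁)) - 2 * ((1 - z) * g - Y) * (k₂ - k₁))
    + 2 * (Y * (1 - (1 - z) * (1 - lam) * g - (1 - z) * lam * (1 - g)) - (1 - z) * lam * g) * (k₂ - k₁) * (S - 2 * k₁)

/-- `T(Y) = Ta2·a² + Ta1·a + Ta0`. -/
theorem qkT_a_expand (Y z g lam S k₁ k₂ a : ℝ) :
    qkT Y z g lam S k₁ k₂ a = qkTa2 Y z g lam * a ^ 2 + qkTa1 Y z g lam S k₁ k₂ * a + qkTa0 Y z g lam S k₁ k₂ := by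
  unfold qkT qkTa2 qkTa1 qkTa0; ring

/-- `FC = (mg)²·T(Y)(a₀)`, `a₀ = (2k₂−S)/(mg)` (a-free). -/
noncomputable def qkFC (Y z g lam S k₁ k₂ : ℝ) : ℝ :=
  qkTa2 Y z g lam * (2 * k₂ - S) ^ 2 + qkTa1 Y z g lam S k₁ k₂ * (2 * k₂ - S) * ((1 - z) * g) + qkTa0 Y z g lam S k₁ k₂ * ((1 - z) * g) ^ 2

/-- `FC = R₂ · FC'` with `FC' = Π·Y(2σ + CY) − 2X_Y(2(k₂−k₁)mg − Y(2k₂ − S))`, `Π = 2k₂ − S − 2mg(k₂−k₁)` (at `a₀`: `d₂ = R₂/mg`, `W₁ = 2(k₂−k₁)`). -/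
noncomputable def qkFCp (Y z g lam S k₁ k₂ : ℝ) : ℝ :=
  (2 * k₂ - S - 2 * ((1 - z) * g) * (k₂ - k₁)) * Y * (2 * ((1 - z) * g - Y) + ((1 - z) * lam * (1 - g)) * Y)
    - 2 * (Y * (1 - (1 - z) * (1 - lam) * g - (1 - z) * lam * (1 - g)) - (1 - z) * lam * g) * (2 * (k₂ - k₁) * ((1 - z) * g) - Y * (2 * k₂ - S))

/-- `FC = R₂ · FC'`. -/
theorem qkFC_factor (Y z g lam S k₁ k₂ : ℝ) :
    qkFC Y z g lam S k₁ k₂ = (2 * k₂ - S - (1 - z) * g * (k₂ - k₁)) * qkFCp Y z g lam S k₁ k₂ := by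
  unfold qkFC qkTa2 qkTa1 qkTa0 qkFCp; ring

/-- `FD = mg·∂ₐT(Y)(a₀)` (a-free). -/
noncomputable def qkFD (Y z g lam S k₁ k₂ : ℝ) : ℝ :=
  2 * qkTa2 Y z g lam * (2 * k₂ - S) + qkTa1 Y z g lam S k₁ k₂ * ((1 - z) * g)

/-- tangent expansion at `a₀`: `(mg)²·T(Y) = FC + W₂·FD + Ta2·W₂²` (`mg(a − a₀) = W₂`). -/
theorem qkT_sk_split (Y z g lam S k₁ k₂ a : ℝ) :
    ((1 - z) * g) ^ 2 * qkT Y z g lam S k₁ k₂ a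
      = qkFC Y z g lam S k₁ k₂ + (S + a * g * (1 - z) - 2 * k₂) * qkFD Y z g lam S k₁ k₂
        + qkTa2 Y z g lam * (S + a * g * (1 - z) - 2 * k₂) ^ 2 := by
  unfold qkFC qkFD; rw [qkT_a_expand]; ring

/-- `a²`-coefficient of `−T'(Y)`: `C(1+mg)(2Y−mg) + 2D(1+mg−2Y)`. -/
noncomputable def qkNa2 (Y z g lam : ℝ) : ℝ :=
  ((1 - z) * lam * (1 - g)) * (1 + (1 - z) * g) * (2 * Y - (1 - z) * g) + 2 * ((1 - z) * lam * g) * (1 + (1 - z) * g - 2 * Y)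

/-- `a¹`-coefficient of `−T'(Y)`. -/
noncomputable def qkNa1 (Y z g lam S k₁ k₂ : ℝ) : ℝ :=
  -2 * (k₂ - k₁) * (((1 - z) * lam * (1 - g)) * (2 * Y - (1 - z) * g) + ((1 - z) * lam * g) * (1 - (2 * Y - (1 - z) * g)))
    - 2 * (S - 2 * k₁) * ((2 * Y - (1 - z) * g) - (1 - (1 - z) * (1 - lam) * g - (1 - z) * lam * (1 - g)))
    - (1 - (1 - z) * g) * ((1 - z) * lam * (1 - g)) * (2 * k₂ - S - 2 * Y * (k₂ - k₁))
    + (S - 2 * k₁) * ((1 - z) * lam * (1 - g)) * (2 * Y - (1 - z) * g)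

/-- `a⁰`-coefficient of `−T'(Y)`. -/
noncomputable def qkNa0 (Y z g lam S k₁ k₂ : ℝ) : ℝ :=
  2 * (k₂ - k₁) * (S - 2 * k₁) * ((2 * Y - (1 - z) * g) - (1 - (1 - z) * (1 - lam) * g - (1 - z) * lam * (1 - g)))
    + (S - 2 * k₁) * ((1 - z) * lam * (1 - g)) * (2 * k₂ - S - 2 * Y * (k₂ - k₁))

/-- `−T'(Y) = Na2·a² + Na1·a + Na0`. -/
theorem qkD_a_expand (Y z g lam S k₁ k₂ a : ℝ) :
    -qkD Y z g lam S k₁ k₂ a = qkNa2 Y z g lam * a ^ 2 + qkNa1 Y z g lam S k₁ k₂ * a + qkNa0 Y z g lam S k₁ k₂ := by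
  unfold qkD qkNa2 qkNa1 qkNa0; ring

/-- `FE = (mg)²·(−T'(Y))(a₀)` (a-free). -/
noncomputable def qkFE (Y z g lam S k₁ k₂ : ℝ) : ℝ :=
  qkNa2 Y z g lam * (2 * k₂ - S) ^ 2 + qkNa1 Y z g lam S k₁ k₂ * (2 * k₂ - S) * ((1 - z) * g) + qkNa0 Y z g lam S k₁ k₂ * ((1 - z) * g) ^ 2

/-- `FF = mg·∂ₐ(−T'(Y))(a₀)` (a-free). -/
noncomputable def qkFF (Y z g lam S k₁ k₂ : ℝ) : ℝ :=
  2 * qkNa2 Y z g lam * (2 * k₂ - S) + qkNa1 Y z g lam S k₁ k₂ * ((1 - z) * g)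

/-- tangent expansion at `a₀`: `(mg)²·(−T'(Y)) = FE + W₂·FF + Na2·W₂²`. -/
theorem qkD_sk_split (Y z g lam S k₁ k₂ a : ℝ) :
    ((1 - z) * g) ^ 2 * (-qkD Y z g lam S k₁ k₂ a)
      = qkFE Y z g lam S k₁ k₂ + (S + a * g * (1 - z) - 2 * k₂) * qkFF Y z g lam S k₁ k₂
        + qkNa2 Y z g lam * (S + a * g * (1 - z) - 2 * k₂) ^ 2 := by
  unfold qkFE qkFF; rw [qkD_a_expand]; ring

/-- `Ta2 ≥ 0` for `0 ≤ Y ≤ mg`, `Y ≤ 1`. -/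
theorem qkTa2_nonneg (Y z g lam : ℝ) (hz1 : z ≤ 1) (hg0 : 0 ≤ g) (hg1 : g ≤ 1) (hlam0 : 0 ≤ lam)
    (hY0 : 0 ≤ Y) (hY1 : Y ≤ 1) (hYmg : Y ≤ (1 - z) * g) : 0 ≤ qkTa2 Y z g lam := by
  unfold qkTa2
  have h1z : 0 ≤ 1 - z := by linarith
  have hC0 : 0 ≤ (1 - z) * lam * (1 - g) := mul_nonneg (mul_nonneg h1z hlam0) (by linarith)
  have hD0 : 0 ≤ (1 - z) * lam * g := mul_nonneg (mul_nonneg h1z hlam0) hg0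
  have hmg : 0 ≤ (1 - z) * g := mul_nonneg h1z hg0
  exact mul_nonneg (by linarith) (add_nonneg (mul_nonneg (mul_nonneg hY0 hC0) (by linarith)) (mul_nonneg (mul_nonneg (by norm_num) hD0) (by linarith)))

/-- `Na2 ≥ 0` for `0 ≤ Y ≤ mg`: `mg·Na2 = (mg − Y)·Na2(0) + Y·Na2(mg)` with both endpoint values nonnegative. -/
theorem qkNa2_nonneg (Y z g lam : ℝ) (hz0 : 0 ≤ z) (hz1 : z ≤ 1) (hg0 : 0 ≤ g) (hg1 : g ≤ 1) (hlam0 : 0 ≤ lam)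
    (hY0 : 0 ≤ Y) (hYmg : Y ≤ (1 - z) * g) (hmg0 : 0 < (1 - z) * g) : 0 ≤ qkNa2 Y z g lam := by
  unfold qkNa2
  have h1z : 0 ≤ 1 - z := by linarith
  have hmg1 : (1 - z) * g ≤ 1 := by
    calc (1 - z) * g ≤ 1 * 1 := mul_le_mul (by linarith) hg1 hg0 (by norm_num)
      _ = 1 := by ring
  have hzg1 : (1 - z) * (1 - g) ≤ 1 := by
    calc (1 - z) * (1 - g) ≤ 1 * 1 := mul_le_mul (by linarith) (by linarith) (by linarith) (by norm_num)
      _ = 1 := by ring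
  have hu : 0 ≤ (1 - z) * lam := mul_nonneg h1z hlam0
  have e : ((1 - z) * g) * (((1 - z) * lam * (1 - g)) * (1 + (1 - z) * g) * (2 * Y - (1 - z) * g)
        + 2 * ((1 - z) * lam * g) * (1 + (1 - z) * g - 2 * Y))
      = ((1 - z) * g - Y) * (((1 - z) * lam) * (1 + (1 - z) * g) * g * (2 - (1 - z) * (1 - g)))
        + Y * (((1 - z) * lam) * ((1 - g) * (1 + (1 - z) * g) * ((1 - z) * g) + 2 * g * (1 - (1 - z) * g))) := by
    ring
  have v0 : 0 ≤ ((1 - z) * lam) * (1 + (1 - z) * g) * g * (2 - (1 - z) * (1 - g)) :=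
    mul_nonneg (mul_nonneg (mul_nonneg hu (by linarith)) hg0) (by linarith)
  have v1 : 0 ≤ ((1 - z) * lam) * ((1 - g) * (1 + (1 - z) * g) * ((1 - z) * g) + 2 * g * (1 - (1 - z) * g)) :=
    mul_nonneg hu (add_nonneg (mul_nonneg (mul_nonneg (by linarith) (by linarith)) hmg0.le) (mul_nonneg (by linarith) (by linarith)))
  have hsum : 0 ≤ ((1 - z) * g - Y) * (((1 - z) * lam) * (1 + (1 - z) * g) * g * (2 - (1 - z) * (1 - g)))
        + Y * (((1 - z) * lam) * ((1 - g) * (1 + (1 - z) * g) * ((1 - z) * g) + 2 * g * (1 - (1 - z) * g))) :=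
    add_nonneg (mul_nonneg (by linarith) v0) (mul_nonneg hY0 v1)
  rw [← e] at hsum
  by_contra hc
  have := mul_neg_of_pos_of_neg hmg0 (not_le.1 hc)
  linarith

end LawDec

end Quant

end Summit.CriticalPhenomena.PercolationContinuityZ3.Theorems
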